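import Summits.QuantumFields.YangMills.Theorems.ParabolicTrajectoryLatticeGapOnTrajectoryTransferFromOSGap
import Summits.QuantumFields.YangMills.Theorems.ParabolicTrajectoryLatticeGapOnTrajectoryTransferHankelTorus
import Summits.QuantumFields.YangMills.Theorems.LatticeGapOnTrajectory.Negative.ZeroCoupling
import Literature.MathematicalPhysics.QuantumFieldTheory.SpeciesTimeReflection
import HarnessLib

/-!
# Crux `LatticeGapOnTrajectory` (stmt-QuantumFields-10523): uniform slab clustering is NOT vacuous —
# it holds (with every rate) at zero coupling (lead c2, line `orbit-kantorovich-finite-size`, reshape 4b)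

Helper file (`--supports stmt-QuantumFields-10523`). The raw lattice hypothesis of the registered stub
`stub_transferSym` — exponential clustering in cluster-expansion format of the reflected diagonal
autocorrelations `osCorr μ_k Θ₀ τ_N X X` of bounded measurable slab observables on the scheme's own
torus — is satisfied by every scheme with `β_k = 0` (product Haar measure: a slab observable reflected
through `t = 0` and its translate by `N` depend on DISJOINT sets of links once `N + 2w ≤ L_k`, so the
reflected autocorrelation vanishes identically; ultralocality as in `Negative/ZeroCoupling`). Hence the
currency carries no hidden contradiction (cf. `Transfer.torusOSGapSlack_of_zero_coupling`, p97088).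

* `dependsOn_comp_negReflect_slab` — `X ∘ Θ₀` of a slab-`1…w` observable depends only on the links
  based at lattice times `≥ S_d − w − 1`;
* `integral_mul_eq_of_dependsOn_disjoint_complex` — ultralocality of a product probability measure for
  bounded measurable COMPLEX observables;
* `uniformSlabClustering_of_zero_coupling` — the registered raw block, with `K = 0`, for `β ≡ 0`.
-/

open scoped ComplexConjugate
open Filter MeasureTheory
open Literature.MathematicalPhysics.QuantumLattice Literature.MathematicalPhysics.QuantumFieldTheory

noncomputable section

namespace Summit.QuantumFields.YangMills.Cruxes.LatticeGapOnTrajectory.OrbitKantorovichFiniteSize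

namespace Transfer

namespace ZeroCouplingUSC

variable {G : Type} [Group G] [TopologicalSpace G] [IsTopologicalGroup G] [CompactSpace G]
  [MeasurableSpace G] [BorelSpace G]

/-! ## §1 Support of the reflected slab observable -/

omit [TopologicalSpace G] [IsTopologicalGroup G] [CompactSpace G] [MeasurableSpace G] [BorelSpace G] in
/-- **Support of `X ∘ Θ₀`.** If `X` depends only on the links based at lattice times `1 … w` and
`w + 2 ≤ S_d`, then `U ↦ X (Θ₀ U)` (`Θ₀ = GaugeConfig.negReflect`, `t ↦ −t`) depends only on the links
based at times `≥ S_d − w − 1` (spatial links go to time `S_d − t`, temporal links based at `t` to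
temporal links based at `S_d − t − 1`). [cite: OsterwalderSeiler1978, §2] -/
theorem dependsOn_comp_negReflect_slab {Sd : ℕ} [NeZero Sd] {α : Type*} {X : GaugeConfig 4 Sd G → α}
    {w : ℕ} (hX : DependsOn X {e : Edge 4 Sd | 1 ≤ (e.1 0).val ∧ (e.1 0).val ≤ w}) (hw : w + 2 ≤ Sd) :
    DependsOn (fun U : GaugeConfig 4 Sd G => X U.negReflect) {e : Edge 4 Sd | Sd - w - 1 ≤ (e.1 0).val} := by
  haveI : Fact (1 < Sd) := ⟨by omega⟩
  intro U V hUV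
  apply hX
  intro e he
  simp only [Set.mem_setOf_eq] at he
  rw [WilsonSiteRP.negReflect_apply, WilsonSiteRP.negReflect_apply]
  have hmem : WilsonSiteRP.siteEdgeReflect e ∈ {e : Edge 4 Sd | Sd - w - 1 ≤ (e.1 0).val} := by
    obtain ⟨x, i⟩ := e
    simp only [Set.mem_setOf_eq]
    unfold WilsonSiteRP.siteEdgeReflect
    by_cases hi : i = 0
    · simp only [hi, ↓reduceIte]
      rw [WilsonSiteRP.val_negReflect_shift_zero]
      simp only at he
      rw [if_neg (by omega)]
      omega
    · simp only [hi, ↓reduceIte]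
      rw [WilsonSiteRP.val_negReflect]
      simp only at he
      rw [if_neg (by omega)]
      omega
  by_cases h2 : e.2 = 0
  · simp only [h2, ↓reduceIte]
    rw [hUV _ hmem]
  · simp only [h2, ↓reduceIte]
    exact hUV _ hmem

/-! ## §2 Ultralocality of a product probability measure, complex observables -/

omit [TopologicalSpace G] [IsTopologicalGroup G] [CompactSpace G] [BorelSpace G] in
/-- **Ultralocality, complex form.** Under a product probability measure, bounded measurable complex
functions depending on DISJOINT finite sets of coordinates are uncorrelated: `∫ f g = ∫ f · ∫ g`
(real and imaginary parts by `Negative.integral_mul_eq_of_dependsOn_disjoint`). [folklore] -/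
theorem integral_mul_eq_of_dependsOn_disjoint_complex {κ : Type*} [Fintype κ] [DecidableEq κ]
    (ν : Measure G) [IsProbabilityMeasure ν] {f g : (κ → G) → ℂ} (I J : Finset κ) (hIJ : Disjoint I J)
    (hf : DependsOn f (↑I : Set κ)) (hg : DependsOn g (↑J : Set κ)) (hfm : Measurable f)
    (hgm : Measurable g) (hfb : ∃ B, ∀ U, ‖f U‖ ≤ B) (hgb : ∃ B, ∀ U, ‖g U‖ ≤ B) :
    ∫ U, f U * g U ∂(Measure.pi fun _ : κ => ν) =
      (∫ U, f U ∂(Measure.pi fun _ : κ => ν)) * ∫ U, g U ∂(Measure.pi fun _ : κ => ν) := by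
  set μ : Measure (κ → G) := Measure.pi fun _ : κ => ν with hμ
  -- real and imaginary parts: measurable, supported as `f`, `g`
  have key : ∀ (φ ψ : (κ → G) → ℝ), DependsOn φ (↑I : Set κ) → DependsOn ψ (↑J : Set κ) →
      Measurable φ → Measurable ψ → ∫ U, φ U * ψ U ∂μ = (∫ U, φ U ∂μ) * ∫ U, ψ U ∂μ :=
    fun φ ψ hφ hψ hφm hψm =>
      Summit.QuantumFields.YangMills.Theorems.LatticeGapOnTrajectory.Negative.integral_mul_eq_of_dependsOn_disjoint
        ν I J hIJ hφ hψ hφm hψm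
  have hfr : DependsOn (fun U => (f U).re) (↑I : Set κ) := fun U V h => by simp only [hf h]
  have hfi : DependsOn (fun U => (f U).im) (↑I : Set κ) := fun U V h => by simp only [hf h]
  have hgr : DependsOn (fun U => (g U).re) (↑J : Set κ) := fun U V h => by simp only [hg h]
  have hgi : DependsOn (fun U => (g U).im) (↑J : Set κ) := fun U V h => by simp only [hg h]
  have hfrm : Measurable fun U => (f U).re := Complex.measurable_re.comp hfm
  have hfim : Measurable fun U => (f U).im := Complex.measurable_im.comp hfm
  have hgrm : Measurable fun U => (g U).re := Complex.measurable_re.comp hgm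
  have hgim : Measurable fun U => (g U).im := Complex.measurable_im.comp hgm
  have k1 := key _ _ hfr hgr hfrm hgrm
  have k2 := key _ _ hfi hgi hfim hgim
  have k3 := key _ _ hfr hgi hfrm hgim
  have k4 := key _ _ hfi hgr hfim hgrm
  -- integrability
  have hfI : Integrable f μ := integrable_of_measurable_bounded hfm hfb
  have hgI : Integrable g μ := integrable_of_measurable_bounded hgm hgb
  have hfgI : Integrable (fun U => f U * g U) μ := by
    obtain ⟨Bf, hBf⟩ := hfb
    obtain ⟨Bg, hBg⟩ := hgb
    exact integrable_of_measurable_bounded (hfm.mul hgm) ⟨Bf * Bg, fun U => by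
      rw [norm_mul]
      exact mul_le_mul (hBf U) (hBg U) (norm_nonneg _) ((norm_nonneg _).trans (hBf U))⟩
  -- compare real and imaginary parts
  obtain ⟨Bg, hBg⟩ := hgb
  have mgr : MemLp (fun U => (g U).re) ⊤ μ := memLp_top_of_bound hgrm.aestronglyMeasurable Bg
    (Eventually.of_forall fun U => (Complex.abs_re_le_norm _).trans (hBg U))
  have mgi : MemLp (fun U => (g U).im) ⊤ μ := memLp_top_of_bound hgim.aestronglyMeasurable Bg
    (Eventually.of_forall fun U => (Complex.abs_im_le_norm _).trans (hBg U))
  have i1 : Integrable (fun U => (f U).re * (g U).re) μ := hfI.re.mul_of_top_left mgr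
  have i2 : Integrable (fun U => (f U).im * (g U).im) μ := hfI.im.mul_of_top_left mgi
  have i3 : Integrable (fun U => (f U).re * (g U).im) μ := hfI.re.mul_of_top_left mgi
  have i4 : Integrable (fun U => (f U).im * (g U).re) μ := hfI.im.mul_of_top_left mgr
  have hre : (∫ U, f U * g U ∂μ).re = ((∫ U, f U ∂μ) * ∫ U, g U ∂μ).re := by
    rw [Complex.mul_re]
    have h1 := integral_re hfgI
    have h2 := integral_re hfI
    have h3 := integral_im hfI
    have h4 := integral_re hgI
    have h5 := integral_im hgI
    simp only [RCLike.re_to_complex, RCLike.im_to_complex] at h1 h2 h3 h4 h5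
    rw [← h1, ← h2, ← h3, ← h4, ← h5, ← k1, ← k2, ← integral_sub i1 i2]
    refine integral_congr_ae (Eventually.of_forall fun U => ?_)
    simp only [Complex.mul_re]
  have him : (∫ U, f U * g U ∂μ).im = ((∫ U, f U ∂μ) * ∫ U, g U ∂μ).im := by
    rw [Complex.mul_im]
    have h1 := integral_im hfgI
    have h2 := integral_re hfI
    have h3 := integral_im hfI
    have h4 := integral_re hgI
    have h5 := integral_im hgI
    simp only [RCLike.re_to_complex, RCLike.im_to_complex] at h1 h2 h3 h4 h5
    rw [← h1, ← h2, ← h3, ← h4, ← h5, ← k3, ← k4, ← integral_add i3 i4]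
    refine integral_congr_ae (Eventually.of_forall fun U => ?_)
    simp only [Complex.mul_im]
  exact Complex.ext hre him

/-! ## §3 Uniform slab clustering at zero coupling -/

/-- **Uniform slab clustering holds at zero coupling, with `K = 0` and every rate.** For a scheme with
`β_k = 0` for all `k` (product Haar measure), eventually in `k` (once `L_k ≥ 1`), for every bounded
measurable `X` of the links based at times `1 … w` and every `N` with `N + 2w ≤ L_k`, the reflected
autocorrelation `osCorr μ_k Θ₀ τ_N X X` VANISHES: `X ∘ Θ₀` lives at times `≥ 2L_k − w` and `X ∘ τ_N` at
times `N+1 … N+w < 2L_k − w`, so the product integral factorises (ultralocality) into `conj(∫X) ∫X` by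
the `Θ₀`- and shift-invariance of the measure. [folklore] -/
theorem uniformSlabClustering_of_zero_coupling (r : LatticeRep G) (sch : SpeciesScheme (YMSpecies G))
    (hβ : ∀ k, sch.β k = 0) (Δ : ℝ) :
    ∃ (p : ℕ) (K : ℝ), 0 ≤ K ∧ ∀ᶠ k in atTop,
      ∀ (w N : ℕ) (X : GaugeConfig 4 (sch.side k) G → ℂ) (B : ℝ), Measurable X → (∀ U, ‖X U‖ ≤ B) →
        DependsOn X {e : Edge 4 (sch.side k) | 1 ≤ (e.1 0).val ∧ (e.1 0).val ≤ w} →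
        N + 2 * w ≤ sch.L k →
          ‖osCorr (wilsonMeasure r.ρ (sch.β k)) GaugeConfig.negReflect (torusTimeShift (sch.side k) N) X X‖ ≤
            K * ((sch.a k)⁻¹ * ((w : ℝ) + 1) * ((sch.L k : ℝ) + 1)) ^ p * B ^ 2 *
              Real.exp (-Δ * sch.a k * N) := by
  refine ⟨0, 0, le_rfl, ?_⟩
  have e1 : ∀ᶠ k in atTop, (1 : ℝ) ≤ sch.a k * sch.L k := sch.tendsto_L.eventually_ge_atTop 1
  have e2 : ∀ᶠ k in atTop, sch.a k ≤ 1 := sch.tendsto_a.eventually_le_const one_pos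
  filter_upwards [e1, e2] with k hk1 hk2 w N X B hX hB hXd hN
  have hL1 : 1 ≤ sch.L k := by
    have h : sch.a k * sch.L k ≤ sch.L k := by
      simpa using mul_le_mul_of_nonneg_right hk2 (Nat.cast_nonneg (sch.L k))
    exact_mod_cast hk1.trans h
  -- the measure is product Haar, `Θ₀`- and shift-invariant
  set μ : Measure (GaugeConfig 4 (sch.side k) G) := wilsonMeasure r.ρ (sch.β k) with hμ
  haveI := isProbabilityMeasure_wilsonMeasure (d := 4) (L := sch.side k) r.ρ r.continuous (sch.β k)
  have hpi : μ = Measure.pi fun _ : Edge 4 (sch.side k) => haarProbability G := by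
    rw [hμ, hβ k]
    exact Summit.QuantumFields.YangMills.Theorems.LatticeGapOnTrajectory.Negative.wilsonMeasure_zero_coupling
      r.ρ (sch.side k)
  -- supports
  have hside : sch.side k = 2 * sch.L k + 1 := rfl
  have hXΘ : DependsOn (fun U => conj (X (GaugeConfig.negReflect U)))
      (↑(Finset.univ.filter fun e : Edge 4 (sch.side k) => sch.side k - w - 1 ≤ (e.1 0).val) :
        Set (Edge 4 (sch.side k))) := by
    have h := dependsOn_comp_negReflect_slab hXd (by omega)
    intro U V hUV
    exact congrArg _ (h (fun e he => hUV e (by simpa using he)))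
  have hXτ : DependsOn (fun U => X (torusTimeShift (sch.side k) N U))
      (↑(Finset.univ.filter fun e : Edge 4 (sch.side k) => 1 + N ≤ (e.1 0).val ∧ (e.1 0).val ≤ w + N) :
        Set (Edge 4 (sch.side k))) := by
    have h := Hankel.dependsOn_comp_torusTimeShift hXd N (by omega)
    intro U V hUV
    exact h (fun e he => hUV e (by simpa using he))
  have hdisj : Disjoint (Finset.univ.filter fun e : Edge 4 (sch.side k) => sch.side k - w - 1 ≤ (e.1 0).val)
      (Finset.univ.filter fun e : Edge 4 (sch.side k) => 1 + N ≤ (e.1 0).val ∧ (e.1 0).val ≤ w + N) := by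
    rw [Finset.disjoint_filter]
    intro e _ h1 h2
    omega
  -- ultralocality
  have hXm : Measurable X := hX
  have hΘm : Measurable fun U : GaugeConfig 4 (sch.side k) G => conj (X U.negReflect) :=
    Complex.continuous_conj.measurable.comp (hXm.comp WilsonSiteRP.measurable_negReflect)
  have hτm : Measurable fun U => X (torusTimeShift (sch.side k) N U) :=
    hXm.comp (torusTimeShift _ _).measurable
  have hfact : ∫ U, conj (X U.negReflect) * X (torusTimeShift (sch.side k) N U) ∂μ =
      (∫ U, conj (X U.negReflect) ∂μ) * ∫ U, X (torusTimeShift (sch.side k) N U) ∂μ := by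
    rw [hpi]
    exact integral_mul_eq_of_dependsOn_disjoint_complex (haarProbability G) _ _ hdisj hXΘ hXτ hΘm hτm
      ⟨B, fun U => by rw [RCLike.norm_conj]; exact hB _⟩ ⟨B, fun U => hB _⟩
  -- invariances of the measure
  have hΘint : ∫ U, conj (X U.negReflect) ∂μ = conj (∫ U, X U ∂μ) := by
    rw [integral_conj]
    exact congrArg _ (integral_comp_negReflect_eq r.ρ r.continuous (sch.β k) X)
  have hτint : ∫ U, X (torusTimeShift (sch.side k) N U) ∂μ = ∫ U, X U ∂μ := by
    have hmp : MeasurePreserving (⇑(torusTimeShift (G := G) (sch.side k) N)) μ μ :=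
      ⟨(torusTimeShift _ _).measurable, by
        unfold torusTimeShift; exact wilsonMeasure_map_torusConfigShift r.ρ (sch.β k) _⟩
    exact hmp.integral_comp' (f := torusTimeShift (sch.side k) N) X
  have hzero : osCorr μ GaugeConfig.negReflect (torusTimeShift (sch.side k) N) X X = 0 := by
    unfold osCorr
    rw [hfact, hΘint, hτint, sub_self]
  rw [hzero, norm_zero]
  simp

end ZeroCouplingUSC

end Transfer

end Summit.QuantumFields.YangMills.Cruxes.LatticeGapOnTrajectory.OrbitKantorovichFiniteSize

end
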